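import Literature.NumberTheory.Transcendental.KaehlerHodge
import Literature.NumberTheory.Transcendental.ComplexFormsProofs
import Literature.NumberTheory.Transcendental.KaehlerHodgeTypeCounterexample
import Literature.Geometry.Kaehler.RiemannianHodgeHarmonicIffCounterexample
import Literature.Geometry.Kaehler.ManifoldFormsChart
import Literature.Geometry.Kaehler.HodgeStarProofs
import Literature.Geometry.Kaehler.HodgeStarOfVolumeFormProofs
import Literature.Geometry.Kaehler.KaehlerProofs
import Mathlib.Topology.Instances.AddCircle.Real
import Mathlib.Analysis.Normed.Group.AddCircle
import Mathlib.LinearAlgebra.Complex.Orientation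
import Mathlib.LinearAlgebra.Complex.FiniteDimensional
import Mathlib.NumberTheory.Real.Irrational
import HarnessLib

/-!
# The named fact `isDolbeaultHarmonic_iff` is false as stated (the `{id, conj}`-rigged torus)

Theorems-only companion of `Literature/NumberTheory/Transcendental/KaehlerHodge.lean` (C12) and of
`KaehlerHodgeDolbeaultHarmonicProofs.lean` (the corrected fact and its discharge).

`KaehlerHodge.lean` records Voisin's "`Ker Δ_∂̄ = Ker ∂̄ ∩ Ker ∂̄*` on a compact manifold" (Hodge Theory
and Complex Algebraic Geometry I, §5.1.2–5.1.4: Lemma 5.12 `(α, Δα) = ‖dα‖² + ‖d*α‖²` "and the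
analogous equalities for the other Laplacians", Cor. 5.13; Huybrechts, *Complex Geometry* (2005),
Lemma 3.2.5: "`α` is `∂̄`-harmonic iff `∂̄α = ∂̄*α = 0`", proof `(Δ_∂̄ α, α) = ‖∂̄*α‖² + ‖∂̄α‖²`) as the
named fact `Literature.NumberTheory.Transcendental.isDolbeaultHarmonic_iff g o`, a `def … : Prop`
written in `section Hermitian` after
`variable … [IsManifold 𝓘(ℂ, E) ω M] [IsManifold 𝓘(ℝ, E) ∞ M] (g …) (o …)`.

**Finding.** The body of the `def` mentions `g` (hence the real tangent bundle and
`[IsManifold 𝓘(ℝ, E) ∞ M]`) but nothing in it uses the *complex*-manifold instance, so Lean did not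
abstract it: `#check @isDolbeaultHarmonic_iff` lists
`{E} [NormedAddCommGroup E] [NormedSpace ℂ E] {M} [TopologicalSpace M] [ChartedSpace E M] {k m : ℕ}
[FiniteDimensional ℂ E] {n : ℕ} [Fact (finrank ℝ E = n)] [IsManifold 𝓘(ℝ, E) ∞ M] (g) (o)` as its
only binders — exactly the defect recorded for `cHodgeLaplacian_eq_two_smul_dolbeaultLaplacian`
(*Correction* note in `KaehlerHodge.lean`) and for `typeComponent_mem_(c)harmonicForms`
(`KaehlerHodgeTypeCounterexample.lean`). The fact is therefore stated for every compact *real* `C^∞`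
manifold whose charts take values in `E`, with the "complex structure" `tangentJ` = multiplication
by `i` in the coordinates of the *preferred chart* `chartAt x`, which is not a tensor unless the
transition maps are holomorphic. This file proves that in that generality the fact is **false**
(`TorusConjAtlas.not_isDolbeaultHarmonic_iff_torus`), records the universal closure over exactly
the binders the fact elaborates with (`not_isDolbeaultHarmonic_iff`; also the surface-level closure
`not_forall_isDolbeaultHarmonic_iff`), and hence that no closed proof
`isDolbeaultHarmonic_iff_holds` can exist. The intended statement carries `[IsManifold 𝓘(ℂ, E) ω M]`
as a binder of the `def` itself: it is the corrected named fact
`Literature.NumberTheory.Transcendental.isDolbeaultHarmonic_iff_of_isManifold`, *proved*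
(`isDolbeaultHarmonic_iff_of_isManifold_holds`, `KaehlerHodgeDolbeaultHarmonicProofs.lean`).

Only the direction "`Δ_∂̄ α = 0 ⇒ ∂̄α = 0 ∧ ∂̄*α = 0`" can fail (the converse is formal), and since
`Δ_∂̄ α = 0` is demanded at *every* point, a counterexample needs the preferred chart to flip on a
dense set; compactness of `M` is part of the statement, so the plane with the `{id, conj}` atlas
(`OriginConjAtlas.Mc`) does not suffice. Hence the torus below.

## The counterexample (`namespace TorusConjAtlas`)

* `M = T² = (ℝ/ℤ)²` (`AddCircle 1 × AddCircle 1`, compact Hausdorff), charted on `E = ℂ` (`n = 2`)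
  by the local inverses of the covering projection `proj : ℂ → T²` **followed by the frame map**
  `L_q (x + iy) = x + i ε(q) y`, where `ε(q) = -1` if the first coordinate of `q` is a rational
  point of `ℝ/ℤ` and `+1` otherwise (`TorusConjAtlas.L`, written in closed form; `L_q ∈ {id, conj}`).
  The structure `chartedSpaceT` is a `def`, used as a local instance. All transition maps are locally
  `y ↦ L_{q₁}(L_{q₀} y - c)` (`transition_eventuallyEq`), so this is a real `C^∞` (indeed real-analytic)
  atlas (`isManifoldT`) — but not a holomorphic one, and the preferred chart is conjugated exactly on
  the dense, co-dense set of rigged points. Consequences: `proj` has manifold derivative `L_{proj w}`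
  (`hasMFDerivAt_proj`), the tangent coordinate changes are the constant maps `L_x ∘ L_{x₀}`
  (`coordChange_eq`), and the chart representative of any form `β` at `x₀` is
  `y ↦ (L_z ∘ L_{x₀})^* β_z`, `z = proj (L_{x₀} y)` (`inChart_apply'`), for every form, smooth or not.
* `metric`: the flat metric `Re ⟪·, ·⟫` on every `T_x T² = ℂ`; in the trivialisation of the bundle
  of bilinear forms at `x₀` it is the *constant* `Re ⟪τ ·, τ ·⟫ = Re ⟪·, ·⟫` on the chart domain
  (`τ = L_x ∘ L_{x₀}` is orthogonal), so it is a `C^∞` metric (`Bundle.ContMDiffRiemannianMetric`);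
  it is Hermitian (`isHermitian`: `Re ⟪iv, iw⟫ = Re ⟪v, w⟫`).
* `orient`: the standard orientation of `ℂ` read in the preferred charts (reversed at rigged
  points); the Riemannian volume form is `ε det₀` pointwise and has the *constant* representatives
  `ε(x₀) det₀`, so the hypothesis `ho` holds (`isSmoothForm_riemannianVolumeForm`).
* The smooth top-degree form `α = (F(x) · vol) ⊗ 1` with `F' = S = sin³(2π ·)` (the functions of
  `TorusRough`, here in the first coordinate; degree `k + 1 = 2`, `m = 0`, so `Δ_∂̄ = ∂̄∂̄*`), of type
  `(1,1)` (`isOfType_alpha`: rotations preserve area). Pointwise linear algebra (the discharged facts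
  `⋆vol = 1`, `⋆⟪v, ·⟫ = ω(v, ·)`) gives `⋆α = F(x)`, `d⋆α = Sc(x) dx` (an honest derivative,
  `mextDeriv_g0_ofReal_apply`), `∂⋆α = ½ Sc(x) dz` (`dolbeault_g0_ofReal`), `⋆dz = -iε dz`, hence
  **`∂̄*α = -⋆∂⋆α = β := (i ε Sc(x) / 2) dz`** (`dolbeaultBarAdjoint_alpha`), which is nonzero at
  `proj (1/4)` (`beta_ne_zero`). So the right-hand side `∂̄α = 0 ∧ ∂̄*α = 0` of the fact fails.
* Yet `α` is "`∂̄`-harmonic": `Δ_∂̄ α = ∂̄β`, `β` has pure type `(1,0)`, and **`dβ = 0` everywhere**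
  (`mextDeriv_beta`): the chart representative of `β` at `x₀` is
  `y ↦ (i ε(z) S(Re y) / 2) · (L_z ∘ L_{x₀})^* dz` with `ε(z) = ρ(Re y)` (`= 1` for irrational,
  `-1` for rational `Re y`); its value on the vector `1` is the scalar `i ρ(Re y) S(Re y) / 2`
  (`inChart_beta_apply_one`), discontinuous wherever `S(Re y) ≠ 0` (`ρ` jumps on every interval), so
  Mathlib's `fderiv` returns the junk value `0` there; where `sin(2π Re y) = 0` one has
  `‖β.inChart x₀ y‖ ≤ |S(Re y)|/2 ≤ (2π)² ‖y - y₀‖² / 2`, so the derivative is genuinely `0`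
  (`hasFDerivAt_inChart_beta`). Hence `∂̄β = 0` (`dolbeaultBar_beta`), `Δ_∂̄ α = 0`
  (`dolbeaultLaplacian_alpha`), and the equivalence fails.

Every identity used holds at every point; the only junk value is the one the fact itself feeds
into `Δ_∂̄` (it quantifies over this real-smooth, non-holomorphic atlas).

## References

* C. Voisin, *Hodge Theory and Complex Algebraic Geometry I*, Cambridge Studies in Advanced
  Mathematics 76 (2002), §5.1.2–5.1.4: Lemma 5.8, Lemma 5.12, Cor. 5.13 — the intended
  (compact complex manifold) statement. [cite: Voisin2002, §5.1.4 Cor. 5.13]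
* D. Huybrechts, *Complex Geometry. An Introduction*, Universitext (2005), Lemma 3.2.3,
  Lemma 3.2.5 — the same statement and its two-line proof. [cite: Huybrechts2005, Lemma 3.2.5]
-/

noncomputable section

open scoped Manifold ContDiff Topology ComplexConjugate InnerProductSpace Real
open Bundle Module Set Filter ContinuousAlternatingMap
open Literature.Geometry.Kaehler

namespace Literature.NumberTheory.Transcendental

namespace TorusConjAtlas

/-! ### The torus `T² = (ℝ/ℤ)²`, charted on `ℂ` -/

/-- The `2`-torus `(ℝ/ℤ)²` (the same type as `Literature.Geometry.Kaehler.TorusRough.T`). [folklore] -/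
abbrev T : Type := AddCircle (1 : ℝ) × AddCircle (1 : ℝ)

/-- The covering projection `ℂ → T²`, `x + iy ↦ (x mod 1, y mod 1)`. [folklore] -/
def proj (z : ℂ) : T := (((z.re : ℝ) : AddCircle (1 : ℝ)), ((z.im : ℝ) : AddCircle (1 : ℝ)))

/-- `proj` is continuous. [folklore] -/
theorem continuous_proj : Continuous proj :=
  ((AddCircle.continuous_mk' (1 : ℝ)).comp Complex.continuous_re).prodMk
    ((AddCircle.continuous_mk' (1 : ℝ)).comp Complex.continuous_im)

/-- `proj` is additive: `proj (z - w) = proj z - proj w`. [folklore] -/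
theorem proj_sub (z w : ℂ) : proj (z - w) = proj z - proj w := by
  simp only [proj, Complex.sub_re, Complex.sub_im, AddCircle.coe_sub, Prod.mk_sub_mk]

/-- Real part of `x + y i`. [folklore] -/
theorem re_ofReal_add_ofReal_mul_I (x y : ℝ) : ((x : ℂ) + (y : ℂ) * Complex.I).re = x := by
  simp

/-- Imaginary part of `x + y i`. [folklore] -/
theorem im_ofReal_add_ofReal_mul_I (x y : ℝ) : ((x : ℂ) + (y : ℂ) * Complex.I).im = y := by
  simp

/-- The local inverse of `proj` on the box `(a, a+1) × (b, b+1)`, as an open partial homeomorphism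
`ℂ ⇀ T²` (a complex-coordinate copy of `TorusRough.cov`). [folklore] -/
def cov (a b : ℝ) : OpenPartialHomeomorph ℂ T where
  toFun := proj
  invFun q := ((AddCircle.equivIco 1 a q.1 : ℝ) : ℂ) + ((AddCircle.equivIco 1 b q.2 : ℝ) : ℂ) * Complex.I
  source := {z | z.re ∈ Ioo a (a + 1) ∧ z.im ∈ Ioo b (b + 1)}
  target := {q | q.1 ≠ (a : AddCircle (1 : ℝ)) ∧ q.2 ≠ (b : AddCircle (1 : ℝ))}
  map_source' := by
    rintro z ⟨h0, h1⟩
    exact ⟨(AddCircle.openPartialHomeomorphCoe 1 a).map_source h0,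
      (AddCircle.openPartialHomeomorphCoe 1 b).map_source h1⟩
  map_target' := by
    rintro q ⟨h0, h1⟩
    refine ⟨?_, ?_⟩
    · rw [re_ofReal_add_ofReal_mul_I]
      exact (AddCircle.openPartialHomeomorphCoe 1 a).map_target h0
    · rw [im_ofReal_add_ofReal_mul_I]
      exact (AddCircle.openPartialHomeomorphCoe 1 b).map_target h1
  left_inv' := by
    rintro z ⟨h0, h1⟩
    apply Complex.ext
    · rw [re_ofReal_add_ofReal_mul_I]
      exact (AddCircle.openPartialHomeomorphCoe 1 a).left_inv h0
    · rw [im_ofReal_add_ofReal_mul_I]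
      exact (AddCircle.openPartialHomeomorphCoe 1 b).left_inv h1
  right_inv' := by
    rintro q -
    refine Prod.ext ?_ ?_
    · change (((((AddCircle.equivIco 1 a q.1 : ℝ) : ℂ) +
        ((AddCircle.equivIco 1 b q.2 : ℝ) : ℂ) * Complex.I).re : ℝ) : AddCircle (1 : ℝ)) = q.1
      rw [re_ofReal_add_ofReal_mul_I]
      exact (AddCircle.equivIco 1 a).symm_apply_apply q.1
    · change (((((AddCircle.equivIco 1 a q.1 : ℝ) : ℂ) +
        ((AddCircle.equivIco 1 b q.2 : ℝ) : ℂ) * Complex.I).im : ℝ) : AddCircle (1 : ℝ)) = q.2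
      rw [im_ofReal_add_ofReal_mul_I]
      exact (AddCircle.equivIco 1 b).symm_apply_apply q.2
  open_source := (isOpen_Ioo.preimage Complex.continuous_re).inter
    (isOpen_Ioo.preimage Complex.continuous_im)
  open_target := (isOpen_compl_singleton.preimage continuous_fst).inter
    (isOpen_compl_singleton.preimage continuous_snd)
  continuousOn_toFun := continuous_proj.continuousOn
  continuousOn_invFun := by
    intro q hq
    have h0 : ContinuousAt (fun q : T ↦ (AddCircle.equivIco 1 a q.1 : ℝ)) q :=
      continuousAt_subtype_val.comp ((AddCircle.continuousAt_equivIco 1 a hq.1).comp continuousAt_fst)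
    have h1 : ContinuousAt (fun q : T ↦ (AddCircle.equivIco 1 b q.2 : ℝ)) q :=
      continuousAt_subtype_val.comp ((AddCircle.continuousAt_equivIco 1 b hq.2).comp continuousAt_snd)
    exact ((Complex.continuous_ofReal.continuousAt.comp h0).add
      ((Complex.continuous_ofReal.continuousAt.comp h1).mul continuousAt_const)).continuousWithinAt

/-- `cov a b` acts as `proj`. [folklore] -/
@[simp]
theorem cov_apply (a b : ℝ) (z : ℂ) : cov a b z = proj z := rfl

/-! ### The rigging: points with rational first coordinate get conjugated charts -/

/-- The rigging predicate: the first coordinate of `q` is a rational point of `ℝ/ℤ`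
(a dense set with dense complement). [folklore] -/
def Flip (q : T) : Prop := q.1 ∈ TorusRough.ratPts

open scoped Classical in
/-- The sign `ε(q) = -1` at rigged points, `+1` elsewhere. [folklore] -/
def sgn (q : T) : ℝ := if Flip q then -1 else 1

/-- `ε(q)² = 1`. [folklore] -/
@[simp] theorem sgn_mul_sgn (q : T) : sgn q * sgn q = 1 := by
  unfold sgn; split_ifs <;> norm_num

/-- `ε(q) ≠ 0`. [folklore] -/
theorem sgn_ne_zero (q : T) : sgn q ≠ 0 := by
  unfold sgn; split_ifs <;> norm_num

/-- `|ε(q)| = 1`. [folklore] -/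
@[simp] theorem abs_sgn (q : T) : |sgn q| = 1 := by
  unfold sgn; split_ifs <;> norm_num

/-- `ε(q) ^ 2 = 1`. [folklore] -/
@[simp] theorem sgn_sq (q : T) : sgn q ^ 2 = 1 := by
  rw [sq, sgn_mul_sgn]

/-- **The frame map** `L_q : ℂ →L[ℝ] ℂ`, `x + iy ↦ x + i ε(q) y`: the identity at unrigged points,
complex conjugation at rigged ones, written in closed form (no case distinction in the data of the
atlas). [folklore] -/
def L (q : T) : ℂ →L[ℝ] ℂ :=
  Complex.reCLM.smulRight (1 : ℂ) + Complex.imCLM.smulRight ((sgn q : ℂ) * Complex.I)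

/-- `L_q v = Re v + i ε(q) Im v`. [folklore] -/
theorem L_apply (q : T) (v : ℂ) :
    L q v = ((v.re : ℝ) : ℂ) + ((sgn q * v.im : ℝ) : ℂ) * Complex.I := by
  simp only [L, _root_.add_apply, ContinuousLinearMap.smulRight_apply,
    Complex.reCLM_apply, Complex.imCLM_apply, Complex.real_smul, mul_one, Complex.ofReal_mul]
  ring

/-- `Re (L_q v) = Re v`. [folklore] -/
@[simp] theorem re_L (q : T) (v : ℂ) : (L q v).re = v.re := by
  rw [L_apply, re_ofReal_add_ofReal_mul_I]

/-- `Im (L_q v) = ε(q) Im v`. [folklore] -/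
@[simp] theorem im_L (q : T) (v : ℂ) : (L q v).im = sgn q * v.im := by
  rw [L_apply, im_ofReal_add_ofReal_mul_I]

/-- `L_q` is an involution. [folklore] -/
@[simp] theorem L_L (q : T) (v : ℂ) : L q (L q v) = v := by
  apply Complex.ext
  · rw [re_L, re_L]
  · rw [im_L, im_L, ← mul_assoc, sgn_mul_sgn, one_mul]

/-- `L_q` preserves the norm. [folklore] -/
@[simp] theorem norm_L (q : T) (v : ℂ) : ‖L q v‖ = ‖v‖ := by
  have h : Complex.normSq (L q v) = Complex.normSq v := by
    rw [Complex.normSq_apply, Complex.normSq_apply, re_L, im_L]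
    linear_combination (v.im * v.im) * sgn_mul_sgn q
  rw [Complex.norm_def, Complex.norm_def, h]

/-- `L_q` preserves the real inner product of `ℂ`. [folklore] -/
theorem inner_L_L (q : T) (v w : ℂ) : ⟪L q v, L q w⟫_ℝ = ⟪v, w⟫_ℝ := by
  rw [Complex.inner, Complex.inner, Complex.mul_re, Complex.mul_re, Complex.conj_re, Complex.conj_im,
    Complex.conj_re, Complex.conj_im, re_L, re_L, im_L, im_L]
  linear_combination (w.im * v.im) * sgn_mul_sgn q

/-- `L_q` as a continuous linear automorphism of `ℂ` (its own inverse). [folklore] -/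
def Le (q : T) : ℂ ≃L[ℝ] ℂ := ContinuousLinearEquiv.equivOfInverse (L q) (L q) (L_L q) (L_L q)

/-- `L_q` as a (global) open partial homeomorphism of `ℂ`. [folklore] -/
def frame (q : T) : OpenPartialHomeomorph ℂ ℂ := (Le q).toHomeomorph.toOpenPartialHomeomorph

/-- `frame q` acts as `L_q`. [folklore] -/
@[simp] theorem frame_apply (q : T) (y : ℂ) : frame q y = L q y := rfl

/-- `(frame q)⁻¹` acts as `L_q`. [folklore] -/
@[simp] theorem frame_symm_apply (q : T) (y : ℂ) : (frame q).symm y = L q y := rfl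

/-- `frame q` is global. [folklore] -/
@[simp] theorem frame_source (q : T) : (frame q).source = univ := rfl

/-- `frame q` is onto. [folklore] -/
@[simp] theorem frame_target (q : T) : (frame q).target = univ := rfl

/-- **The preferred chart of `T²` at `q`**: the inverse of `cov` on a box centred at a lift of `q`,
followed by the frame map `L_q` (so: an honest chart at unrigged points, a conjugated one at rigged
points). [folklore] -/
def chartT (q : T) : OpenPartialHomeomorph T ℂ :=
  (cov (TorusRough.shift q.1) (TorusRough.shift q.2)).symm ≫ₕ frame q

/-- The source of the preferred chart at `q` is the target of the covering piece. [folklore] -/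
theorem chartT_source (q : T) :
    (chartT q).source = (cov (TorusRough.shift q.1) (TorusRough.shift q.2)).target := by
  rw [chartT, OpenPartialHomeomorph.trans_source, frame_source, preimage_univ, inter_univ,
    OpenPartialHomeomorph.symm_source]

/-- `q` lies in the source of its preferred chart. [folklore] -/
theorem mem_chartT_source (q : T) : q ∈ (chartT q).source := by
  rw [chartT_source]
  exact ⟨TorusRough.ne_coe_shift q.1, TorusRough.ne_coe_shift q.2⟩

/-- The inverse of the preferred chart at `q` is `proj ∘ L_q` (as a function on all of `ℂ`).
[folklore] -/
@[simp] theorem chartT_symm_apply (q : T) (y : ℂ) : (chartT q).symm y = proj (L q y) := rfl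

/-- The preferred chart at `q` is `L_q` after the local inverse of `proj`. [folklore] -/
theorem chartT_apply (q : T) (x : T) :
    chartT q x = L q ((cov (TorusRough.shift q.1) (TorusRough.shift q.2)).symm x) := rfl

/-- **The rigged charted-space structure on `T²`** modelled on `ℂ` (a `def`, used as a local
instance and supplied explicitly to the fact under refutation). [folklore] -/
@[reducible]
def chartedSpaceT : ChartedSpace ℂ T where
  atlas := range chartT
  chartAt := chartT
  mem_chart_source := mem_chartT_source
  chart_mem_atlas q := mem_range_self q

/-- Near any `w` with `proj w` in the target, `(cov a b)⁻¹ ∘ proj` is a translation. [folklore] -/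
theorem cov_symm_proj_eventuallyEq (a b : ℝ) (w : ℂ) (hw : proj w ∈ (cov a b).target) :
    ∃ c : ℂ, (fun z ↦ (cov a b).symm (proj z)) =ᶠ[𝓝 w] fun z ↦ z - c := by
  set u := (cov a b).symm (proj w) with hu
  refine ⟨w - u, ?_⟩
  have hus : u ∈ (cov a b).source := (cov a b).map_target hw
  have hπ : proj u = proj w := (cov a b).right_inv hw
  have h1 : Tendsto (fun z : ℂ ↦ z - (w - u)) (𝓝 w) (𝓝 u) := by
    have : Tendsto (fun z : ℂ ↦ z - (w - u)) (𝓝 w) (𝓝 (w - (w - u))) :=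
      (continuous_id.sub continuous_const).tendsto w
    rwa [sub_sub_cancel] at this
  filter_upwards [h1 ((cov a b).open_source.mem_nhds hus)] with z hz
  have hp : proj (z - (w - u)) = proj z := by
    rw [proj_sub, proj_sub, hπ, sub_self, sub_zero]
  rw [← hp]
  exact (cov a b).left_inv hz

/-- **The transition maps are locally affine**: near a point `y` of the overlap,
`chartT q₁ ∘ (chartT q₀)⁻¹ = L_{q₁} (L_{q₀} (·) - c)`. [folklore] -/
theorem transition_eventuallyEq (q₀ q₁ : T) {y : ℂ} (hy : proj (L q₀ y) ∈ (chartT q₁).source) :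
    ∃ c : ℂ, (fun y ↦ chartT q₁ ((chartT q₀).symm y)) =ᶠ[𝓝 y] fun y ↦ L q₁ (L q₀ y - c) := by
  rw [chartT_source] at hy
  obtain ⟨c, hc⟩ := cov_symm_proj_eventuallyEq _ _ (L q₀ y) hy
  refine ⟨c, ?_⟩
  have hc' := hc.comp_tendsto (L q₀).continuous.continuousAt
  filter_upwards [hc'] with y' hy'
  simp only [Function.comp_apply] at hy'
  rw [chartT_symm_apply, chartT_apply, hy']

section Charts

attribute [local instance] chartedSpaceT

/-- The preferred chart at `q` is `chartT q`. [folklore] -/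
theorem chartAt_eq (q : T) : chartAt ℂ q = chartT q := rfl

/-- **`T²` with the rigged atlas is a real `C^∞` manifold** (all transition maps are locally of
the form `y ↦ L_{q₁} (L_{q₀} y - c)`, real-affine). [folklore] -/
theorem isManifoldT : IsManifold 𝓘(ℝ, ℂ) ∞ T := by
  refine isManifold_of_contDiffOn _ _ _ ?_
  rintro e e' ⟨q₀, rfl⟩ ⟨q₁, rfl⟩
  intro y hy
  simp only [modelWithCornersSelf_coe, modelWithCornersSelf_coe_symm, Set.preimage_id,
    Set.range_id, Set.inter_univ, Function.comp_id, Function.id_comp] at hy ⊢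
  have hy1 : proj (L q₀ y) ∈ (chartT q₁).source := by
    have := hy.2
    simpa using this
  obtain ⟨c, hc⟩ := transition_eventuallyEq q₀ q₁ hy1
  have hsm : ContDiff ℝ ∞ (fun y ↦ L q₁ (L q₀ y - c)) :=
    (L q₁).contDiff.comp ((L q₀).contDiff.sub contDiff_const)
  change ContDiffWithinAt ℝ ∞ (fun y ↦ chartT q₁ ((chartT q₀).symm y)) _ y
  exact (hsm.contDiffAt.congr_of_eventuallyEq hc).contDiffWithinAt

attribute [local instance] isManifoldT

/-- The inverse extended chart at `q` is `proj ∘ L_q`. [folklore] -/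
theorem extChartAt_symm_apply (q : T) (y : ℂ) : (extChartAt 𝓘(ℝ, ℂ) q).symm y = proj (L q y) := rfl

/-- The extended chart at `q` is `L_q` after the local inverse of `proj`. [folklore] -/
theorem extChartAt_apply (q x : T) :
    extChartAt 𝓘(ℝ, ℂ) q x = L q ((cov (TorusRough.shift q.1) (TorusRough.shift q.2)).symm x) := rfl

/-- The canonical lift of `q` (the centre of the preferred chart, read through `L_q`). [folklore] -/
def lift (q : T) : ℂ := L q (extChartAt 𝓘(ℝ, ℂ) q q)

/-- `proj (lift q) = q`. [folklore] -/
theorem proj_lift (q : T) : proj (lift q) = q :=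
  (extChartAt 𝓘(ℝ, ℂ) q).left_inv (mem_extChartAt_source q)

/-- `Re (lift q)` is `Re` of the chart centre. [folklore] -/
theorem re_lift (q : T) : (lift q).re = (extChartAt 𝓘(ℝ, ℂ) q q).re := re_L _ _

/-- **`proj` has manifold derivative `L_{proj w}` at `w`** (its expression in the charts is
locally `z ↦ L (z - c)`). [folklore] -/
theorem hasMFDerivAt_proj (w : ℂ) :
    HasMFDerivAt 𝓘(ℝ, ℂ) 𝓘(ℝ, ℂ) proj w (L (proj w)) := by
  refine ⟨continuous_proj.continuousAt, ?_⟩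
  have hw0 : proj w ∈ (cov (TorusRough.shift (proj w).1) (TorusRough.shift (proj w).2)).target :=
    ⟨TorusRough.ne_coe_shift _, TorusRough.ne_coe_shift _⟩
  obtain ⟨c, hc⟩ := cov_symm_proj_eventuallyEq _ _ w hw0
  have hwr : writtenInExtChartAt 𝓘(ℝ, ℂ) 𝓘(ℝ, ℂ) w proj =
      fun z ↦ L (proj w) ((cov (TorusRough.shift (proj w).1) (TorusRough.shift (proj w).2)).symm
        (proj z)) := by
    funext z
    simp only [writtenInExtChartAt, extChartAt_coe, extChartAt_coe_symm, modelWithCornersSelf_coe,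
      modelWithCornersSelf_coe_symm, Function.comp_apply, id_eq]
    rfl
  rw [hwr, ModelWithCorners.Boundaryless.range_eq_univ, hasFDerivWithinAt_univ, extChartAt_self_apply,
    modelWithCornersSelf_coe, id_eq]
  have hd : HasFDerivAt (fun z ↦ L (proj w) (z - c)) (L (proj w)) w := by
    have := (L (proj w)).hasFDerivAt.comp w ((hasFDerivAt_id w).sub_const c)
    rwa [ContinuousLinearMap.comp_id] at this
  exact hd.congr_of_eventuallyEq (hc.fun_comp (L (proj w)))

/-- **The derivative of the inverse extended chart** `proj ∘ L_{x₀}` at `y` is `L_z ∘ L_{x₀}`,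
`z = proj (L_{x₀} y)`. [folklore] -/
theorem mfderivWithin_extChartAt_symm (x₀ : T) (y : ℂ) :
    mfderivWithin 𝓘(ℝ, ℂ) 𝓘(ℝ, ℂ) (↑(extChartAt 𝓘(ℝ, ℂ) x₀).symm) (range 𝓘(ℝ, ℂ)) y =
      (L (proj (L x₀ y))).comp (L x₀) := by
  have h : (↑(extChartAt 𝓘(ℝ, ℂ) x₀).symm : ℂ → T) = proj ∘ L x₀ := funext (extChartAt_symm_apply x₀)
  rw [h, ModelWithCorners.Boundaryless.range_eq_univ, mfderivWithin_univ]
  have hL : HasMFDerivAt 𝓘(ℝ, ℂ) 𝓘(ℝ, ℂ) (L x₀) y (L x₀) :=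
    hasMFDerivAt_iff_hasFDerivAt.2 (L x₀).hasFDerivAt
  exact ((hasMFDerivAt_proj (L x₀ y)).comp y hL).mfderiv

/-- The transition `L_z ∘ L_{x₀}`, typed as a map into the tangent space at `z` (the type at which
it enters `MForm.inChart`). [folklore] -/
def τT (x₀ z : T) : ℂ →L[ℝ] TangentSpace 𝓘(ℝ, ℂ) z := (L z).comp (L x₀)

/-- `Re (τ v) = Re v`. [folklore] -/
@[simp] theorem re_τT (x₀ z : T) (v : ℂ) : Complex.re (τT x₀ z v) = v.re := by
  change (L z (L x₀ v)).re = v.re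
  rw [re_L, re_L]

/-- `Im (τ v) = ε(z) ε(x₀) Im v`. [folklore] -/
@[simp] theorem im_τT (x₀ z : T) (v : ℂ) : Complex.im (τT x₀ z v) = sgn z * sgn x₀ * v.im := by
  change (L z (L x₀ v)).im = _
  rw [im_L, im_L, mul_assoc]

/-- `‖τ v‖ = ‖v‖`. [folklore] -/
@[simp] theorem norm_τT (x₀ z : T) (v : ℂ) : ‖(show ℂ from τT x₀ z v)‖ = ‖v‖ := by
  change ‖L z (L x₀ v)‖ = ‖v‖
  rw [norm_L, norm_L]

/-- **Values of the chart representative** of a form on the rigged torus: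
`(α.inChart x₀ y)(v) = α_z (τ v)`, `z = proj (L_{x₀} y)`, `τ = L_z ∘ L_{x₀}`; valid at every
`y ∈ ℂ`, for every form. [folklore] -/
theorem inChart_apply' {F : Type*} [NormedAddCommGroup F] [NormedSpace ℝ F] {k : ℕ}
    (α : MForm 𝓘(ℝ, ℂ) T F k) (x₀ : T) (y : ℂ) (v : Fin k → ℂ) :
    α.inChart x₀ y v = α (proj (L x₀ y)) (fun i ↦ τT x₀ (proj (L x₀ y)) (v i)) := by
  rw [MForm.inChart_apply]
  simp only [mfderivWithin_extChartAt_symm]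
  rfl

/-- The manifold exterior derivative at `x` vanishes as soon as the chart representative at `x`
has derivative `0` at the centre (unfolding of `mextDeriv`; valid on any charted space).
[folklore] -/
theorem mextDeriv_apply_eq_zero {F : Type*} [NormedAddCommGroup F] [NormedSpace ℝ F] {k : ℕ}
    {α : MForm 𝓘(ℝ, ℂ) T F k} {x : T}
    (h : fderivWithin ℝ (α.inChart x) (range 𝓘(ℝ, ℂ)) (extChartAt 𝓘(ℝ, ℂ) x x) = 0) :
    mextDeriv α x = 0 := by
  rw [mextDeriv, extDerivWithin, h]
  ext v
  simp [ContinuousAlternatingMap.alternatizeUncurryFin_apply]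

/-! ### The flat metric, as a `C^∞` Riemannian metric on the rigged torus -/

/-- The tangent coordinate change of the rigged torus between the charts at `x₀` and `x`, at a
point `x` of the overlap, is the constant map `L_x ∘ L_{x₀}`. [folklore] -/
theorem coordChange_eq {x₀ x : T} (hx : x ∈ (chartAt ℂ x₀).source) :
    (tangentBundleCore 𝓘(ℝ, ℂ) T).coordChange (achart ℂ x₀) (achart ℂ x) x = (L x).comp (L x₀) := by
  rw [tangentBundleCore_coordChange_achart, ModelWithCorners.Boundaryless.range_eq_univ,
    fderivWithin_univ]
  have hx1 : proj (L x₀ (chartT x₀ x)) ∈ (chartT x).source := by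
    have : proj (L x₀ (chartT x₀ x)) = x := (chartT x₀).left_inv hx
    rw [this]
    exact mem_chartT_source x
  obtain ⟨c, hc⟩ := transition_eventuallyEq x₀ x hx1
  have hd : HasFDerivAt (fun y ↦ L x (L x₀ y - c)) ((L x).comp (L x₀)) (chartT x₀ x) :=
    (L x).hasFDerivAt.comp _ ((L x₀).hasFDerivAt.sub_const c)
  have heq : (↑(extChartAt 𝓘(ℝ, ℂ) x) ∘ ↑(extChartAt 𝓘(ℝ, ℂ) x₀).symm : ℂ → ℂ) =
      fun y ↦ chartT x ((chartT x₀).symm y) := by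
    funext y; rfl
  rw [heq]
  exact (hd.congr_of_eventuallyEq hc).fderiv

set_option backward.isDefEq.respectTransparency false in
/-- **The flat metric** `g_x = Re ⟪·, ·⟫` on every tangent space `T_x T² = ℂ` (rigged chart
coordinates), as a `C^∞` Riemannian metric: on the chart domain of `x₀` its expression in the
trivialisation of `Hom(T, Hom(T, ℝ))` at `x₀` is the constant `Re ⟪τ ·, τ ·⟫ = Re ⟪·, ·⟫`,
`τ = L_x ∘ L_{x₀}` being orthogonal. [folklore] -/
def metric : ContMDiffRiemannianMetric 𝓘(ℝ, ℂ) ∞ ℂ (fun x : T ↦ TangentSpace 𝓘(ℝ, ℂ) x) where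
  inner _ := (innerSL ℝ (E := ℂ) : ℂ →L[ℝ] ℂ →L[ℝ] ℝ)
  symm _ v w := by
    change @inner ℝ ℂ _ v w = @inner ℝ ℂ _ w v
    exact real_inner_comm _ _
  pos _ v hv := by
    change 0 < @inner ℝ ℂ _ v v
    exact real_inner_self_pos.2 hv
  isVonNBounded _ := by
    change Bornology.IsVonNBounded ℝ {v : ℂ | @inner ℝ ℂ _ v v < 1}
    have : Metric.ball (0 : ℂ) 1 = {v : ℂ | @inner ℝ ℂ _ v v < 1} := by
      ext v
      simp only [Metric.mem_ball, dist_zero_right, norm_eq_sqrt_re_inner (𝕜 := ℝ),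
        RCLike.re_to_real, Set.mem_setOf_eq]
      conv_lhs => rw [show (1 : ℝ) = √1 by simp]
      rw [Real.sqrt_lt_sqrt_iff]
      exact real_inner_self_nonneg
    rw [← this]
    exact NormedSpace.isVonNBounded_ball ℝ ℂ 1
  contMDiff := by
    intro x₀
    rw [contMDiffAt_section]
    refine (contMDiffAt_const (c := (innerSL ℝ (E := ℂ) : ℂ →L[ℝ] ℂ →L[ℝ] ℝ))).congr_of_eventuallyEq ?_
    filter_upwards [(chartAt ℂ x₀).open_source.mem_nhds (mem_chart_source ℂ x₀)] with x hx
    ext v w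
    rw [trivializationAt_bilinForm_apply₂, TangentBundle.symmL_trivializationAt_eq_core hx,
      coordChange_eq hx]
    change @inner ℝ ℂ _ (L x (L x₀ v)) (L x (L x₀ w)) = @inner ℝ ℂ _ v w
    rw [inner_L_L, inner_L_L]

/-- The flat metric as a `RiemannianBundle` structure (a reducible `def`, used as a *local*
instance below; it is the instance `⟨g.toRiemannianMetric⟩` installed by the fact under
refutation). [folklore] -/
@[reducible]
def bundle : RiemannianBundle (fun x : T ↦ TangentSpace 𝓘(ℝ, ℂ) x) := ⟨metric.toRiemannianMetric⟩

attribute [local instance] bundle Complex.finrank_real_complex_fact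

/-- `⟪u, v⟫ = Re u Re v + Im u Im v` on `T_x T²` for the flat metric. [folklore] -/
theorem inner_eq (x : T) (u v : TangentSpace 𝓘(ℝ, ℂ) x) :
    ⟪u, v⟫_ℝ = Complex.re u * Complex.re v + Complex.im u * Complex.im v := by
  change @inner ℝ ℂ _ u v = _
  rw [Complex.inner, Complex.mul_re, Complex.conj_re, Complex.conj_im]
  ring

/-- The basis `1, i` of `T_x T² = ℂ`. [folklore] -/
def basisT (x : T) : Basis (Fin 2) ℝ (TangentSpace 𝓘(ℝ, ℂ) x) := Complex.basisOneI

/-- `basisT = (1, i)`. [folklore] -/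
theorem basisT_apply (x : T) (i : Fin 2) : basisT x i = (![1, Complex.I] : Fin 2 → ℂ) i :=
  congrFun Complex.coe_basisOneI i

/-- Coordinates in `basisT` are `(Re, Im)`. [folklore] -/
theorem basisT_repr (x : T) (v : TangentSpace 𝓘(ℝ, ℂ) x) (i : Fin 2) :
    (basisT x).repr v i = ![Complex.re v, Complex.im v] i :=
  congrFun (Complex.coe_basisOneI_repr v) i

/-- `1, i` is orthonormal for the flat metric. [folklore] -/
theorem basisT_orthonormal (x : T) : Orthonormal ℝ (basisT x) := by
  rw [orthonormal_iff_ite]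
  intro i j
  fin_cases i <;> fin_cases j <;> rw [inner_eq] <;> simp [basisT_apply]

/-- The orthonormal basis `1, i` of `T_x T²`. [folklore] -/
def onBasis (x : T) : OrthonormalBasis (Fin 2) ℝ (TangentSpace 𝓘(ℝ, ℂ) x) :=
  (basisT x).toOrthonormalBasis (basisT_orthonormal x)

/-- The underlying basis of `onBasis` is `basisT`. [folklore] -/
theorem toBasis_onBasis (x : T) : (onBasis x).toBasis = basisT x :=
  Basis.toBasis_toOrthonormalBasis _ _

/-- The standard orientation of `ℂ` on `T_x T²` (rigged chart coordinates). [folklore] -/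
def stdOrient (x : T) : Orientation ℝ (TangentSpace 𝓘(ℝ, ℂ) x) (Fin 2) := (basisT x).orientation

open scoped Classical in
/-- **The orientation family**: the standard orientation of the chart coordinates at unrigged
points, the reversed one at rigged points — i.e. the standard orientation of the honest torus
read in the preferred (possibly conjugated) charts. [folklore] -/
def orient (x : T) : Orientation ℝ (TangentSpace 𝓘(ℝ, ℂ) x) (Fin 2) :=
  if Flip x then -stdOrient x else stdOrient x

/-- The standard determinant `det₀(v, w) = Re v Im w - Im v Re w`. [folklore] -/
theorem basisT_det_apply (x : T) (v : Fin 2 → TangentSpace 𝓘(ℝ, ℂ) x) :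
    (basisT x).det v = Complex.re (v 0) * Complex.im (v 1) - Complex.im (v 0) * Complex.re (v 1) := by
  rw [Basis.det_apply, Matrix.det_fin_two]
  simp only [Basis.toMatrix_apply, basisT_repr]
  simp
  ring

/-- The volume form of the standard orientation is `det₀`. [folklore] -/
theorem volumeForm_stdOrient (x : T) (v : Fin 2 → TangentSpace 𝓘(ℝ, ℂ) x) :
    (stdOrient x).volumeForm v = (basisT x).det v := by
  have ho : (onBasis x).toBasis.orientation = stdOrient x := by rw [toBasis_onBasis]; rfl
  rw [Orientation.volumeForm_robust _ (onBasis x) ho, toBasis_onBasis]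

/-- The volume form of `o`: `vol_x = ε(x) det₀` on `T_x T²`. [folklore] -/
theorem volumeForm_orient (x : T) (v : Fin 2 → TangentSpace 𝓘(ℝ, ℂ) x) :
    (orient x).volumeForm v = sgn x * (basisT x).det v := by
  unfold orient sgn
  split_ifs
  · rw [Orientation.volumeForm_neg_orientation, AlternatingMap.neg_apply, volumeForm_stdOrient]
    ring
  · rw [volumeForm_stdOrient]; ring

/-- **The Riemannian volume form** of `(T², g, o)`: `vol_x(v) = ε(x) det₀(v)`. [folklore] -/
theorem riemannianVolumeForm_apply' (x : T) (v : Fin 2 → TangentSpace 𝓘(ℝ, ℂ) x) :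
    riemannianVolumeForm orient x v =
      sgn x * (Complex.re (v 0) * Complex.im (v 1) - Complex.im (v 0) * Complex.re (v 1)) := by
  rw [Literature.Geometry.Kaehler.riemannianVolumeForm_apply, Orientation.volumeFormL_apply,
    volumeForm_orient, basisT_det_apply]

/-- The cocycle relation `ε(z) · (ε(z) ε(x₀)) = ε(x₀)`. [folklore] -/
theorem sgn_mul_sgn_mul_sgn (x₀ z : T) : sgn z * (sgn z * sgn x₀) = sgn x₀ := by
  rw [← mul_assoc, sgn_mul_sgn, one_mul]

/-- The chart representatives of the volume form are constant: `vol.inChart x₀ = ε(x₀) det₀`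
(`det(L_z ∘ L_{x₀}) = ε(z) ε(x₀)`). [folklore] -/
theorem inChart_riemannianVolumeForm (x₀ : T) (y : ℂ) :
    (riemannianVolumeForm orient).inChart x₀ y = sgn x₀ • OriginConjAtlas.det₀ := by
  ext v
  rw [inChart_apply', riemannianVolumeForm_apply', ContinuousAlternatingMap.smul_apply, smul_eq_mul,
    OriginConjAtlas.det₀_apply]
  simp only [re_τT, im_τT]
  linear_combination ((v 0).re * (v 1).im - (v 0).im * (v 1).re) * sgn_mul_sgn_mul_sgn x₀ (proj (L x₀ y))

/-- **The hypothesis `ho`**: the volume form of `(T², g, o)` is smooth. [folklore] -/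
theorem isSmoothForm_riemannianVolumeForm : IsSmoothForm (riemannianVolumeForm orient) := by
  intro x
  rw [funext (inChart_riemannianVolumeForm x)]
  exact contDiffWithinAt_const

/-- **`g` is Hermitian**: `Re ⟪iv, iw⟫ = Re ⟪v, w⟫` at every point. [folklore] -/
theorem isHermitian : Bundle.RiemannianMetric.IsHermitian metric.toRiemannianMetric := by
  intro x v w
  change @inner ℝ ℂ _ (Complex.I * show ℂ from v) (Complex.I * show ℂ from w) =
    @inner ℝ ℂ _ (show ℂ from v) (show ℂ from w)
  rw [Complex.inner, Complex.inner]
  simp only [map_mul, Complex.conj_I]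
  ring_nf
  simp

/-! ### Reference forms: `dx`, `dy`, `dz`, `dz̄` (rigged chart coordinates) -/

/-- `Re` as a real functional on `T_x T² = ℂ`. [folklore] -/
def reT (x : T) : TangentSpace 𝓘(ℝ, ℂ) x →L[ℝ] ℝ := Complex.reCLM

/-- `Im` as a real functional on `T_x T² = ℂ`. [folklore] -/
def imT (x : T) : TangentSpace 𝓘(ℝ, ℂ) x →L[ℝ] ℝ := Complex.imCLM

/-- The real `1`-form `dx = Re` (chart coordinates). [folklore] -/
def dx : MForm 𝓘(ℝ, ℂ) T ℝ 1 := fun x ↦ ofSubsingleton ℝ (TangentSpace 𝓘(ℝ, ℂ) x) ℝ (0 : Fin 1) (reT x)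

/-- The real `1`-form `dy = Im` (chart coordinates). [folklore] -/
def dy : MForm 𝓘(ℝ, ℂ) T ℝ 1 := fun x ↦ ofSubsingleton ℝ (TangentSpace 𝓘(ℝ, ℂ) x) ℝ (0 : Fin 1) (imT x)

/-- `dx(v) = Re v`. [folklore] -/
@[simp] theorem dx_apply (x : T) (v : Fin 1 → TangentSpace 𝓘(ℝ, ℂ) x) : dx x v = Complex.re (v 0) := rfl

/-- `dy(v) = Im v`. [folklore] -/
@[simp] theorem dy_apply (x : T) (v : Fin 1 → TangentSpace 𝓘(ℝ, ℂ) x) : dy x v = Complex.im (v 0) := rfl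

/-- The identity of `T_x T² = ℂ`, as a real-linear map into `ℂ`. [folklore] -/
def idT (x : T) : TangentSpace 𝓘(ℝ, ℂ) x →L[ℝ] ℂ := ContinuousLinearMap.id ℝ ℂ

/-- Complex conjugation of `T_x T² = ℂ`, as a real-linear map into `ℂ`. [folklore] -/
def conjT (x : T) : TangentSpace 𝓘(ℝ, ℂ) x →L[ℝ] ℂ := (Complex.conjCLE : ℂ →L[ℝ] ℂ)

/-- The complex `1`-form `dz` (the identity at every point, chart coordinates). [folklore] -/
def dz : MForm 𝓘(ℝ, ℂ) T ℂ 1 := fun x ↦ ofSubsingleton ℝ (TangentSpace 𝓘(ℝ, ℂ) x) ℂ (0 : Fin 1) (idT x)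

/-- The complex `1`-form `dz̄` (conjugation at every point, chart coordinates). [folklore] -/
def dzbar : MForm 𝓘(ℝ, ℂ) T ℂ 1 :=
  fun x ↦ ofSubsingleton ℝ (TangentSpace 𝓘(ℝ, ℂ) x) ℂ (0 : Fin 1) (conjT x)

/-- `dz(v) = v`. [folklore] -/
@[simp] theorem dz_apply (x : T) (v : Fin 1 → TangentSpace 𝓘(ℝ, ℂ) x) : dz x v = (v 0 : ℂ) := rfl

/-- `dz̄(v) = v̄`. [folklore] -/
@[simp] theorem dzbar_apply (x : T) (v : Fin 1 → TangentSpace 𝓘(ℝ, ℂ) x) :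
    dzbar x v = (starRingEnd ℂ) (v 0 : ℂ) := rfl

/-- `dz` has type `(1,0)`. [folklore] -/
theorem isOfType_dz : IsOfType 1 0 dz := by
  refine ⟨rfl, fun x θ v ↦ ?_⟩
  rw [dz_apply, dz_apply, tangentRotate_apply]
  simp

/-- `dz̄` has type `(0,1)`. [folklore] -/
theorem isOfType_dzbar : IsOfType 0 1 dzbar := by
  refine ⟨rfl, fun x θ v ↦ ?_⟩
  rw [dzbar_apply, dzbar_apply, tangentRotate_apply]
  simp only [smul_eq_mul, map_mul, ← Complex.exp_conj, Complex.conj_ofReal, Complex.conj_I,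
    Nat.cast_zero, Nat.cast_one, zero_sub, Int.cast_neg, Int.cast_one]
  ring_nf

/-- A pointwise multiple `c • dz` (any coefficient function `c`) has type `(1,0)`. [folklore] -/
theorem isOfType_smul_dz (c : T → ℂ) : IsOfType 1 0 (fun x ↦ c x • dz x) := by
  refine ⟨rfl, fun x θ v ↦ ?_⟩
  rw [ContinuousAlternatingMap.smul_apply, ContinuousAlternatingMap.smul_apply, smul_eq_mul,
    smul_eq_mul, ← mul_assoc, mul_comm (Complex.exp _) (c x), mul_assoc, ← isOfType_dz.2 x θ v]

/-- A pointwise multiple `c • dz̄` has type `(0,1)`. [folklore] -/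
theorem isOfType_smul_dzbar (c : T → ℂ) : IsOfType 0 1 (fun x ↦ c x • dzbar x) := by
  refine ⟨rfl, fun x θ v ↦ ?_⟩
  rw [ContinuousAlternatingMap.smul_apply, ContinuousAlternatingMap.smul_apply, smul_eq_mul,
    smul_eq_mul, ← mul_assoc, mul_comm (Complex.exp _) (c x), mul_assoc, ← isOfType_dzbar.2 x θ v]

/-- `dx = ⟪1, ·⟫` for the flat metric. [folklore] -/
theorem reT_eq_innerSL (x : T) :
    (reT x : TangentSpace 𝓘(ℝ, ℂ) x →L[ℝ] ℝ) =
      innerSL ℝ (E := TangentSpace 𝓘(ℝ, ℂ) x) ((1 : ℂ) : TangentSpace 𝓘(ℝ, ℂ) x) := by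
  ext w
  rw [innerSL_apply_apply, inner_eq]
  change Complex.re w = _
  simp

/-- `dy = ⟪i, ·⟫` for the flat metric. [folklore] -/
theorem imT_eq_innerSL (x : T) :
    (imT x : TangentSpace 𝓘(ℝ, ℂ) x →L[ℝ] ℝ) =
      innerSL ℝ (E := TangentSpace 𝓘(ℝ, ℂ) x) ((Complex.I : ℂ) : TangentSpace 𝓘(ℝ, ℂ) x) := by
  ext w
  rw [innerSL_apply_apply, inner_eq]
  change Complex.im w = _
  simp

/-- **`⋆dx = ε dy`** pointwise: `(⋆dx)(w) = ε(x) Im w` (`⋆⟪v, ·⟫ = ω_o(v, ·)`,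
`hodgeStar_apply_eq_areaForm_holds`). [folklore] -/
theorem hodgeStar_dx_apply (h : 0 + 1 + 1 = 2) (x : T) (w : TangentSpace 𝓘(ℝ, ℂ) x) :
    hodgeStar (orient x) h (dx x) ![w] = sgn x * Complex.im w := by
  change hodgeStar (orient x) h (ofSubsingleton ℝ (TangentSpace 𝓘(ℝ, ℂ) x) ℝ (0 : Fin 1) (reT x))
    ![w] = _
  rw [reT_eq_innerSL x, hodgeStar_apply_eq_areaForm_holds (orient x) h,
    Orientation.areaForm_to_volumeForm, volumeForm_orient, basisT_det_apply]
  simp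

/-- **`⋆dy = -ε dx`** pointwise: `(⋆dy)(w) = -ε(x) Re w`. [folklore] -/
theorem hodgeStar_dy_apply (h : 0 + 1 + 1 = 2) (x : T) (w : TangentSpace 𝓘(ℝ, ℂ) x) :
    hodgeStar (orient x) h (dy x) ![w] = -(sgn x * Complex.re w) := by
  change hodgeStar (orient x) h (ofSubsingleton ℝ (TangentSpace 𝓘(ℝ, ℂ) x) ℝ (0 : Fin 1) (imT x))
    ![w] = _
  rw [imT_eq_innerSL x, hodgeStar_apply_eq_areaForm_holds (orient x) h,
    Orientation.areaForm_to_volumeForm, volumeForm_orient, basisT_det_apply]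
  simp

/-! ### The smooth top-degree form `α = F(x) · vol`, `F' = sin³(2π ·)` -/

/-- The coefficient `G(q) = F(x)` on `T²` (`F` the `1`-periodic primitive of `sin³(2π ·)` of
`TorusRough`, here as a function of the *first* coordinate). [folklore] -/
def G (q : T) : ℝ := TorusRough.Fc q.1

/-- `G (proj w) = F (Re w)`. [folklore] -/
theorem G_proj (w : ℂ) : G (proj w) = TorusRough.F w.re := TorusRough.Fc_coe _

/-- `Sc (proj w).1 = S (Re w)`. [folklore] -/
theorem Sc_proj (w : ℂ) : TorusRough.Sc (proj w).1 = TorusRough.S w.re := TorusRough.Sc_coe _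

/-- `S` at the canonical lift of `q` is `Sc q.1`. [folklore] -/
theorem S_lift (q : T) : TorusRough.S (lift q).re = TorusRough.Sc q.1 := by
  conv_rhs => rw [← proj_lift q]
  exact (Sc_proj (lift q)).symm

/-- The real top-degree form `G · vol`. [folklore] -/
def alphaR : MForm 𝓘(ℝ, ℂ) T ℝ 2 := fun q ↦ G q • riemannianVolumeForm orient q

/-- **The form `α = (G · vol) ⊗ 1`**, a smooth complex `2`-form of type `(1,1)`. [folklore] -/
def alpha : MForm 𝓘(ℝ, ℂ) T ℂ 2 := alphaR.ofReal

/-- The chart representatives of `G · vol`: `y ↦ F(Re y) ε(x₀) det₀`. [folklore] -/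
theorem inChart_alphaR (x₀ : T) (y : ℂ) :
    alphaR.inChart x₀ y = (TorusRough.F y.re * sgn x₀) • OriginConjAtlas.det₀ := by
  ext v
  rw [inChart_apply']
  simp only [alphaR, ContinuousAlternatingMap.smul_apply, smul_eq_mul, G_proj, re_L,
    riemannianVolumeForm_apply', OriginConjAtlas.det₀_apply, re_τT, im_τT]
  linear_combination (TorusRough.F y.re * ((v 0).re * (v 1).im - (v 0).im * (v 1).re)) *
    sgn_mul_sgn_mul_sgn x₀ (proj (L x₀ y))

/-- `G · vol` is smooth. [folklore] -/
theorem isSmoothForm_alphaR : IsSmoothForm alphaR := by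
  intro x
  rw [funext (inChart_alphaR x)]
  have hre : ContDiff ℝ ∞ (fun y : ℂ ↦ y.re) := Complex.reCLM.contDiff
  exact (((TorusRough.contDiff_F.comp hre).mul contDiff_const).smul contDiff_const).contDiffWithinAt

/-- **`α` is smooth.** [folklore] -/
theorem isSmoothForm_alpha : IsSmoothForm alpha := isSmoothForm_alphaR.ofReal

/-- Values of `α`: `α_x(v, w) = G(x) ε(x) det₀(v, w)`. [folklore] -/
theorem alpha_apply (x : T) (v : Fin 2 → TangentSpace 𝓘(ℝ, ℂ) x) :
    alpha x v = ((G x * (sgn x * (Complex.re (v 0) * Complex.im (v 1) -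
      Complex.im (v 0) * Complex.re (v 1))) : ℝ) : ℂ) := by
  rw [alpha, MForm.ofReal_apply]
  simp only [alphaR, ContinuousAlternatingMap.smul_apply, smul_eq_mul, riemannianVolumeForm_apply']

/-- Rotations preserve the standard area: `det₀(e^{iθ}a, e^{iθ}b) = det₀(a, b)`. [folklore] -/
theorem det₀_rotate (θ : ℝ) (a b : ℂ) :
    (Complex.exp (θ * Complex.I) * a).re * (Complex.exp (θ * Complex.I) * b).im -
        (Complex.exp (θ * Complex.I) * a).im * (Complex.exp (θ * Complex.I) * b).re =
      a.re * b.im - a.im * b.re := by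
  have h1 : Real.cos θ ^ 2 + Real.sin θ ^ 2 = 1 := Real.cos_sq_add_sin_sq θ
  simp only [Complex.mul_re, Complex.mul_im, Complex.exp_ofReal_mul_I_re,
    Complex.exp_ofReal_mul_I_im]
  linear_combination (a.re * b.im - a.im * b.re) * h1

/-- **`α` has type `(1,1)`** (every `2`-form on a complex curve has: rotations preserve area).
[folklore] -/
theorem isOfType_alpha : IsOfType 1 1 alpha := by
  refine ⟨rfl, fun x θ v ↦ ?_⟩
  rw [alpha_apply, alpha_apply]
  simp only [tangentRotate_apply, smul_eq_mul]
  rw [det₀_rotate]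
  simp

/-! ### `⋆α`, `∂⋆α`, `⋆∂⋆α`: the form `∂̄*α = -⋆∂⋆α` in closed form -/

/-- The real `0`-form `G`. [folklore] -/
def g0 : MForm 𝓘(ℝ, ℂ) T ℝ 0 := fun q ↦ constOfIsEmpty ℝ (TangentSpace 𝓘(ℝ, ℂ) q) (Fin 0) (G q)

/-- `⋆(G · vol) = G` pointwise (`⋆vol = 1`, `hodgeStar_volumeFormL_holds`). [folklore] -/
theorem hodgeStar_alphaR (h : 1 + 1 + 0 = 2) (q : T) : MForm.hodgeStar orient h alphaR q = g0 q := by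
  rw [MForm.hodgeStar_apply]
  change hodgeStar (orient q) h ((G q) • (orient q).volumeFormL) = _
  rw [map_smul, hodgeStar_volumeFormL_holds (orient q) h]
  ext v
  simp [g0]

/-- **`⋆α = G ⊗ 1`** (the complex star is the `ℂ`-linear extension). [folklore] -/
theorem cHodgeStar_alpha (h : 1 + 1 + 0 = 2) : MForm.cHodgeStar orient h alpha = g0.ofReal := by
  rw [alpha, MForm.cHodgeStar_ofReal]
  exact congrArg MForm.ofReal (funext (hodgeStar_alphaR h))

/-- Every complex `0`-form has type `(0,0)`. [folklore] -/
theorem isOfType_zero_zero (γ : MForm 𝓘(ℝ, ℂ) T ℂ 0) : IsOfType 0 0 γ :=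
  ⟨rfl, fun x θ v ↦ by
    have hv : (fun i ↦ tangentRotate ℂ x θ (v i)) = v := funext fun i ↦ Fin.elim0 i
    rw [hv]
    simp⟩

/-- The chart representatives of `G ⊗ 1` are `y ↦ F(Re y)` (in every chart). [folklore] -/
theorem inChart_g0_ofReal (x₀ : T) (y : ℂ) :
    (g0.ofReal).inChart x₀ y = constOfIsEmpty ℝ ℂ (Fin 0) ((TorusRough.F y.re : ℝ) : ℂ) := by
  ext v
  rw [inChart_apply', MForm.ofReal_apply]
  simp [g0, G_proj]

/-- `y ↦ F(Re y)` (complex-valued) has derivative `S(Re c) · Re` at `c`. [folklore] -/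
theorem hasFDerivAt_F_re (c : ℂ) :
    HasFDerivAt (fun y : ℂ ↦ ((TorusRough.F y.re : ℝ) : ℂ))
      (Complex.ofRealCLM.comp (TorusRough.S c.re • Complex.reCLM)) c := by
  have h1 : HasFDerivAt (fun y : ℂ ↦ TorusRough.F y.re) (TorusRough.S c.re • Complex.reCLM) c :=
    (TorusRough.hasDerivAt_F c.re).comp_hasFDerivAt c Complex.reCLM.hasFDerivAt
  exact Complex.ofRealCLM.hasFDerivAt.comp c h1

/-- **`d(G ⊗ 1) = Sc(x) dx`**: the manifold derivative of the `0`-form `G` evaluated on `v` is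
`Sc(q.1) Re v` (an honest derivative: `mextDeriv_eq_extDerivWithin`, `extDeriv_constOfIsEmpty`).
[folklore] -/
theorem mextDeriv_g0_ofReal_apply (q : T) (v : Fin 1 → TangentSpace 𝓘(ℝ, ℂ) q) :
    mextDeriv g0.ofReal q v = ((TorusRough.Sc q.1 * Complex.re (v 0) : ℝ) : ℂ) := by
  rw [mextDeriv_eq_extDerivWithin, funext (inChart_g0_ofReal q),
    ModelWithCorners.Boundaryless.range_eq_univ, extDerivWithin_univ, extDeriv_constOfIsEmpty,
    (hasFDerivAt_F_re _).fderiv, ← S_lift, re_lift]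
  rfl

/-- Half of `Sc(x)`: the common coefficient of `dz` and `dz̄` in `d(G ⊗ 1)`. [folklore] -/
def a2 (q : T) : ℝ := TorusRough.Sc q.1 / 2

/-- `d(G ⊗ 1) = a dz + a dz̄`, `a = Sc(x)/2`. [folklore] -/
theorem mextDeriv_g0_ofReal_eq :
    mextDeriv g0.ofReal = (fun q ↦ ((a2 q : ℝ) : ℂ) • dz q) + fun q ↦ ((a2 q : ℝ) : ℂ) • dzbar q := by
  funext q; ext v
  rw [mextDeriv_g0_ofReal_apply]
  simp only [a2, Pi.add_apply, ContinuousAlternatingMap.add_apply, ContinuousAlternatingMap.smul_apply,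
    dz_apply, dzbar_apply, smul_eq_mul]
  apply Complex.ext
  · simp only [Complex.ofReal_re, Complex.add_re, Complex.mul_re, Complex.ofReal_im, zero_mul,
      sub_zero, Complex.conj_re]
    ring
  · simp only [Complex.ofReal_im, Complex.add_im, Complex.mul_im, Complex.ofReal_re, zero_mul,
      add_zero, Complex.conj_im]
    ring

/-- **`∂(⋆α) = a dz`**, `a = Sc(x)/2` (only the `(1,0)`-part of `d(G ⊗ 1) = a dz + a dz̄` survives).
[folklore] -/
theorem dolbeault_g0_ofReal : dolbeault g0.ofReal = fun q ↦ ((a2 q : ℝ) : ℂ) • dz q := by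
  rw [dolbeault, Finset.Nat.antidiagonal_zero, Finset.sum_singleton,
    (isOfType_zero_zero _).typeComponent_eq_self, mextDeriv_g0_ofReal_eq, MForm.typeComponent_add,
    (isOfType_smul_dz _).typeComponent_eq_self,
    IsOfType.typeComponent_of_ne_holds (isOfType_smul_dzbar _) (Or.inl (by norm_num)), add_zero]

/-- The real part of `a dz` (`a` real) is `a dx`. [folklore] -/
theorem re_smul_dz (a : T → ℝ) :
    MForm.re (fun q ↦ ((a q : ℝ) : ℂ) • dz q) = fun q ↦ a q • dx q := by
  funext q; ext v
  simp [MForm.re_apply]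

/-- The imaginary part of `a dz` (`a` real) is `a dy`. [folklore] -/
theorem im_smul_dz (a : T → ℝ) :
    MForm.im (fun q ↦ ((a q : ℝ) : ℂ) • dz q) = fun q ↦ a q • dy q := by
  funext q; ext v
  simp [MForm.im_apply]

/-- **`⋆(a dz) = -i ε a dz`** for a real coefficient function `a` (`⋆dx = ε dy`, `⋆dy = -ε dx`).
[folklore] -/
theorem cHodgeStar_smul_dz (h : 0 + 1 + 1 = 2) (a : T → ℝ) :
    MForm.cHodgeStar orient h (fun q ↦ ((a q : ℝ) : ℂ) • dz q) =
      fun q ↦ (((-(sgn q * a q) : ℝ) : ℂ) * Complex.I) • dz q := by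
  funext q; ext v
  obtain ⟨w, rfl⟩ : ∃ w, v = ![w] := ⟨v 0, by funext i; fin_cases i; rfl⟩
  rw [MForm.cHodgeStar_apply, re_smul_dz, im_smul_dz]
  change ((hodgeStar (orient q) h (a q • dx q) ![w] : ℝ) : ℂ) +
      Complex.I * ((hodgeStar (orient q) h (a q • dy q) ![w] : ℝ) : ℂ) =
    ((((-(sgn q * a q) : ℝ) : ℂ) * Complex.I) • dz q) ![w]
  rw [map_smul, map_smul, ContinuousAlternatingMap.smul_apply, ContinuousAlternatingMap.smul_apply,
    hodgeStar_dx_apply h, hodgeStar_dy_apply h, ContinuousAlternatingMap.smul_apply, dz_apply,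
    smul_eq_mul, smul_eq_mul, smul_eq_mul, Matrix.cons_val_zero]
  apply Complex.ext
  · simp only [Complex.add_re, Complex.ofReal_re, Complex.mul_re, Complex.I_re, zero_mul,
      Complex.I_im, Complex.ofReal_im, mul_zero, sub_zero, zero_sub, Complex.mul_im,
      add_zero, Complex.neg_re, Complex.ofReal_neg, neg_mul, mul_one]
    ring
  · simp only [Complex.add_im, Complex.ofReal_im, Complex.mul_im, Complex.I_re, mul_zero,
      Complex.I_im, Complex.ofReal_re, mul_one, zero_add, Complex.mul_re, sub_zero, zero_mul,
      Complex.neg_im, Complex.ofReal_neg, neg_mul, add_zero, one_mul]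
    ring

/-- The real coefficient `b(q) = ε(q) Sc(q.1) / 2` of `∂̄*α = i b dz`. [folklore] -/
def bR (q : T) : ℝ := sgn q * TorusRough.Sc q.1 / 2

/-- **The form `β = i b dz`**, `b = ε Sc(x) / 2` (which is `∂̄*α`, `dolbeaultBarAdjoint_alpha`).
[folklore] -/
def beta : MForm 𝓘(ℝ, ℂ) T ℂ 1 := fun q ↦ (((bR q : ℝ) : ℂ) * Complex.I) • dz q

/-- **`∂̄*α = β`**: `∂̄*α = -⋆∂⋆α = -⋆(a dz) = i ε a dz`. [folklore] -/
theorem dolbeaultBarAdjoint_alpha (h : 1 + 1 + 0 = 2) : dolbeaultBarAdjoint orient h alpha = beta := by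
  rw [dolbeaultBarAdjoint, cHodgeStar_alpha h, dolbeault_g0_ofReal, cHodgeStar_smul_dz]
  funext q; ext v
  simp only [beta, bR, a2, Pi.neg_apply, ContinuousAlternatingMap.neg_apply,
    ContinuousAlternatingMap.smul_apply, smul_eq_mul, dz_apply]
  push_cast
  ring

/-- `β` has type `(1,0)`. [folklore] -/
theorem isOfType_beta : IsOfType 1 0 beta := isOfType_smul_dz _

/-! ### The junk analysis: `dβ = 0` everywhere -/

open scoped Classical in
/-- The sign `ρ(t) = 1` for irrational `t`, `-1` for rational `t`. [folklore] -/
def ρ (t : ℝ) : ℝ := if Irrational t then 1 else -1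

/-- `|ρ| = 1`. [folklore] -/
@[simp] theorem abs_ρ (t : ℝ) : |ρ t| = 1 := by
  unfold ρ; split_ifs <;> norm_num

/-- A point `proj w` is rigged iff `Re w` is rational. [folklore] -/
theorem flip_proj_iff (w : ℂ) : Flip (proj w) ↔ ¬ Irrational w.re := by
  constructor
  · intro hF hirr
    exact TorusRough.coe_not_mem_ratPts hirr hF
  · intro h
    unfold Irrational at h
    push Not at h
    obtain ⟨r, hr⟩ := h
    change ((w.re : ℝ) : AddCircle (1 : ℝ)) ∈ TorusRough.ratPts
    rw [← hr]
    exact TorusRough.coe_rat_mem_ratPts r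

/-- `ε(proj w) = ρ(Re w)`. [folklore] -/
theorem sgn_proj (w : ℂ) : sgn (proj w) = ρ w.re := by
  unfold sgn ρ
  by_cases h : Irrational w.re
  · rw [if_neg ((flip_proj_iff w).not.2 (not_not.2 h)), if_pos h]
  · rw [if_pos ((flip_proj_iff w).2 h), if_neg h]

/-- `ρ` is continuous nowhere (`1` on the irrationals, `-1` on the rationals). [folklore] -/
theorem not_continuousAt_ρ (t : ℝ) : ¬ ContinuousAt ρ t := by
  intro hL
  obtain ⟨δ, hδ, hball⟩ := Metric.continuousAt_iff.1 hL 1 (by norm_num)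
  obtain ⟨r, hr1, hr2⟩ := exists_rat_btwn (show t < t + δ by linarith)
  obtain ⟨i, hi, hi1, hi2⟩ := exists_irrational_btwn (show t < t + δ by linarith)
  have hr := hball (x := r) (by rw [Real.dist_eq, abs_lt]; constructor <;> linarith)
  have hi' := hball (x := i) (by rw [Real.dist_eq, abs_lt]; constructor <;> linarith)
  rw [Real.dist_eq, ρ, if_neg (Rat.not_irrational r)] at hr
  rw [Real.dist_eq, ρ, if_pos hi] at hi'
  unfold ρ at hr hi'
  by_cases ht : Irrational t
  · rw [if_pos ht] at hr
    norm_num at hr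
  · rw [if_neg ht] at hi'
    norm_num at hi'

/-- **The chart representative of `β` evaluated on `1`** is the scalar
`y ↦ i ρ(Re y) S(Re y) / 2`, which jumps wherever `S ≠ 0`. [folklore] -/
theorem inChart_beta_apply_one (x₀ : T) (y : ℂ) :
    beta.inChart x₀ y ![(1 : ℂ)] = ((ρ y.re * TorusRough.S y.re / 2 : ℝ) : ℂ) * Complex.I := by
  rw [inChart_apply']
  simp only [beta, bR, ContinuousAlternatingMap.smul_apply, smul_eq_mul, dz_apply, Sc_proj, re_L,
    sgn_proj, Matrix.cons_val_zero]
  have h1 : @Eq ℂ (τT x₀ (proj (L x₀ y)) 1) 1 := by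
    apply Complex.ext
    · rw [re_τT, Complex.one_re]
    · rw [im_τT, Complex.one_im, mul_zero]
  rw [h1, mul_one]

/-- **Norm of the chart representative of `β`**: `‖β.inChart x₀ y‖ ≤ |S(Re y)| / 2`
(`|b| = |S|/2`, `τ` is an isometry). [folklore] -/
theorem norm_inChart_beta_le (x₀ : T) (y : ℂ) : ‖beta.inChart x₀ y‖ ≤ |TorusRough.S y.re| / 2 := by
  refine ContinuousAlternatingMap.opNorm_le_bound _ (by positivity) fun v ↦ ?_
  rw [inChart_apply', Fin.prod_univ_one]
  simp only [beta, bR, ContinuousAlternatingMap.smul_apply, smul_eq_mul, dz_apply, Sc_proj, re_L]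
  rw [norm_mul, norm_mul, Complex.norm_I, mul_one, norm_τT, Complex.norm_real, Real.norm_eq_abs,
    abs_div, abs_mul, abs_sgn, one_mul, abs_two]

/-- At a zero of `sin(2π ·)`: `|S(Re y)| ≤ (2π)² ‖y - y₀‖²` (second-order vanishing of `sin³`).
[folklore] -/
theorem abs_S_re_le {y₀ : ℂ} (h0 : Real.sin (2 * π * y₀.re) = 0) (y : ℂ) :
    |TorusRough.S y.re| ≤ (2 * π) ^ 2 * ‖y - y₀‖ ^ 2 := by
  obtain ⟨n, hn⟩ := Real.sin_eq_zero_iff.1 h0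
  have hsin : |Real.sin (2 * π * y.re)| ≤ 2 * π * ‖y - y₀‖ := by
    have : 2 * π * y.re = 2 * π * (y.re - y₀.re) + n * π := by rw [hn]; ring
    rw [this, Real.sin_add_int_mul_pi, abs_mul, abs_zpow, abs_neg, abs_one, one_zpow, one_mul]
    refine le_trans Real.abs_sin_le_abs ?_
    rw [abs_mul, abs_of_pos (by positivity : (0 : ℝ) < 2 * π)]
    gcongr
    simpa using Complex.abs_re_le_norm (y - y₀)
  have hs1 : |Real.sin (2 * π * y.re)| ≤ 1 := Real.abs_sin_le_one _
  have hnn : 0 ≤ 2 * π * ‖y - y₀‖ := by positivity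
  calc |TorusRough.S y.re| = |Real.sin (2 * π * y.re)| ^ 2 * |Real.sin (2 * π * y.re)| := by
        rw [TorusRough.S, abs_pow]; ring
    _ ≤ (2 * π * ‖y - y₀‖) ^ 2 * 1 := by gcongr
    _ = (2 * π) ^ 2 * ‖y - y₀‖ ^ 2 := by ring

/-- At a zero of `sin(2π Re ·)` the representative of `β` is differentiable with derivative `0`
(it vanishes to second order). [folklore] -/
theorem hasFDerivAt_inChart_beta {x₀ : T} {y₀ : ℂ} (h0 : Real.sin (2 * π * y₀.re) = 0) :
    HasFDerivAt (beta.inChart x₀) (0 : ℂ →L[ℝ] ℂ [⋀^Fin 1]→L[ℝ] ℂ) y₀ := by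
  have hb0 : beta.inChart x₀ y₀ = 0 := by
    have := norm_inChart_beta_le x₀ y₀
    have hS : TorusRough.S y₀.re = 0 := by simp [TorusRough.S, h0]
    rw [hS, abs_zero, zero_div] at this
    exact norm_le_zero_iff.1 this
  rw [hasFDerivAt_iff_isLittleO_nhds_zero]
  simp only [hb0, sub_zero, _root_.zero_apply]
  have hO : (fun h : ℂ ↦ beta.inChart x₀ (y₀ + h)) =O[𝓝 0] fun h : ℂ ↦ ‖h - 0‖ ^ 2 := by
    refine Asymptotics.IsBigO.of_bound ((2 * π) ^ 2 / 2) (Filter.Eventually.of_forall fun h ↦ ?_)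
    rw [sub_zero, Real.norm_of_nonneg (by positivity)]
    have h1 := norm_inChart_beta_le x₀ (y₀ + h)
    have h2 := abs_S_re_le h0 (y₀ + h)
    rw [add_sub_cancel_left] at h2
    nlinarith [norm_nonneg h]
  have hlo : (fun h : ℂ ↦ ‖h - 0‖ ^ 2) =o[𝓝 0] fun h : ℂ ↦ h :=
    (Asymptotics.isLittleO_pow_sub_sub (0 : ℂ) one_lt_two).congr_right fun h ↦ sub_zero h
  exact hO.trans_isLittleO hlo

/-- Where `S(Re y) ≠ 0` the representative of `β` is not continuous, hence not differentiable
(its value on `1` is `i ρ S / 2`, and `ρ` jumps on every interval). [folklore] -/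
theorem not_differentiableAt_inChart_beta {x₀ : T} {y : ℂ} (hy : TorusRough.S y.re ≠ 0) :
    ¬ DifferentiableAt ℝ (beta.inChart x₀) y := by
  intro hd
  have hc : ContinuousAt (fun y ↦ beta.inChart x₀ y ![(1 : ℂ)]) y :=
    ((ContinuousAlternatingMap.apply ℝ ℂ ℂ ![(1 : ℂ)]).continuous.continuousAt).comp hd.continuousAt
  simp only [inChart_beta_apply_one] at hc
  -- restrict to the horizontal line through `y`
  have hline : Continuous fun t : ℝ ↦ ((t : ℝ) : ℂ) + ((y.im : ℝ) : ℂ) * Complex.I := by fun_prop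
  have hy' : ((y.re : ℝ) : ℂ) + ((y.im : ℝ) : ℂ) * Complex.I = y := Complex.re_add_im y
  have h1 : ContinuousAt (fun t : ℝ ↦ ((ρ t * TorusRough.S t / 2 : ℝ) : ℂ) * Complex.I) y.re := by
    have := hc.comp_of_eq hline.continuousAt hy'
    simpa [Function.comp_def] using this
  have h2 : ContinuousAt (fun t : ℝ ↦ ρ t * TorusRough.S t / 2) y.re := by
    have := Complex.continuous_im.continuousAt.comp h1
    simpa [Function.comp_def] using this
  have h3 : ContinuousAt (fun t : ℝ ↦ (ρ t * TorusRough.S t / 2) / (TorusRough.S t / 2)) y.re :=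
    h2.div (TorusRough.continuous_S.div_const _).continuousAt (div_ne_zero hy two_ne_zero)
  have h4 : (fun t : ℝ ↦ (ρ t * TorusRough.S t / 2) / (TorusRough.S t / 2)) =ᶠ[𝓝 y.re] ρ := by
    have hne : ∀ᶠ t in 𝓝 y.re, TorusRough.S t ≠ 0 :=
      TorusRough.continuous_S.continuousAt.eventually_ne hy
    filter_upwards [hne] with t ht
    field_simp
  exact not_continuousAt_ρ y.re (h3.congr h4)

/-- **`fderiv (β.inChart x₀) = 0` everywhere**: a junk zero where `S(Re y) ≠ 0` (no continuity),
a genuine zero where `sin(2π Re y) = 0` (second-order vanishing). [folklore] -/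
theorem fderiv_inChart_beta (x₀ : T) (y : ℂ) : fderiv ℝ (beta.inChart x₀) y = 0 := by
  by_cases hS : Real.sin (2 * π * y.re) = 0
  · exact (hasFDerivAt_inChart_beta hS).fderiv
  · exact fderiv_zero_of_not_differentiableAt
      (not_differentiableAt_inChart_beta (pow_ne_zero 3 hS))

/-- **`dβ = 0`** at every point of the rigged torus. [folklore] -/
theorem mextDeriv_beta : mextDeriv beta = 0 := by
  funext x
  exact mextDeriv_apply_eq_zero (by
    rw [ModelWithCorners.Boundaryless.range_eq_univ, fderivWithin_univ]
    exact fderiv_inChart_beta x _)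

/-- **`∂̄β = 0`**: `β` has pure type `(1,0)` and `dβ = 0`. [folklore] -/
theorem dolbeaultBar_beta : dolbeaultBar beta = 0 := by
  rw [dolbeaultBar, Finset.Nat.sum_antidiagonal_eq_sum_range_succ_mk, Finset.sum_range_succ,
    Finset.sum_range_succ, Finset.sum_range_zero, zero_add]
  rw [IsOfType.typeComponent_of_ne_holds isOfType_beta (Or.inl (by norm_num)), mextDeriv_zero,
    MForm.typeComponent_zero, zero_add, isOfType_beta.typeComponent_eq_self, mextDeriv_beta,
    MForm.typeComponent_zero]

/-! ### Assembly -/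

/-- **`Δ_∂̄ α = 0`**: in top degree `Δ_∂̄ = ∂̄∂̄*`, and `∂̄(∂̄*α) = ∂̄β = 0`. [folklore] -/
theorem dolbeaultLaplacian_alpha (h : 1 + 1 + 0 = 2) : dolbeaultLaplacian orient (1 + 1) 0 h alpha = 0 := by
  simp only [dolbeaultLaplacian]
  rw [dolbeaultBarAdjoint_alpha, dolbeaultBar_beta]

/-- **`α` is `∂̄`-harmonic of type `(1,1)`** on the rigged torus. [folklore] -/
theorem isDolbeaultHarmonic_alpha (h : 1 + 1 + 0 = 2) : IsDolbeaultHarmonic orient 1 1 h alpha :=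
  ⟨isSmoothForm_alpha, isOfType_alpha, dolbeaultLaplacian_alpha h⟩

/-- `Sc` at the point `proj (1/4)` is `sin³(π/2) = 1`. [folklore] -/
theorem Sc_quarter : TorusRough.Sc (proj ((4⁻¹ : ℝ) : ℂ)).1 = 1 := by
  rw [Sc_proj, Complex.ofReal_re, TorusRough.S, show 2 * π * 4⁻¹ = π / 2 by ring, Real.sin_pi_div_two]
  norm_num

/-- **`β ≠ 0`**: at `proj (1/4)` it takes the value `± i/2` on the vector `1`. [folklore] -/
theorem beta_ne_zero : beta ≠ 0 := by
  intro H
  have key := congrArg (fun γ : MForm 𝓘(ℝ, ℂ) T ℂ 1 ↦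
    γ (proj ((4⁻¹ : ℝ) : ℂ)) (![(1 : ℂ)] : Fin 1 → TangentSpace 𝓘(ℝ, ℂ) (proj ((4⁻¹ : ℝ) : ℂ)))) H
  simp only [beta, bR, Sc_quarter, Pi.zero_apply, ContinuousAlternatingMap.coe_zero,
    ContinuousAlternatingMap.smul_apply, smul_eq_mul, dz_apply, Matrix.cons_val_zero, mul_one,
    mul_eq_zero, Complex.I_ne_zero, or_false, Complex.ofReal_eq_zero, div_eq_zero_iff,
    OfNat.ofNat_ne_zero] at key
  exact sgn_ne_zero _ key

/-- **`∂̄*α ≠ 0`.** [folklore] -/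
theorem dolbeaultBarAdjoint_alpha_ne_zero (h : 1 + 1 + 0 = 2) : dolbeaultBarAdjoint orient h alpha ≠ 0 := by
  rw [dolbeaultBarAdjoint_alpha h]
  exact beta_ne_zero

/-- **The named fact `isDolbeaultHarmonic_iff` is false for the rigged torus** (`E = ℂ`,
`n = 2`, degree `k + 1 = 2`, `m = 0`, type `(1,1)`, the flat `C^∞` metric `metric`, which is
Hermitian, and the orientation family `orient`, whose volume form is smooth): `α = (F(x) vol) ⊗ 1`
is smooth, of type `(1,1)` and `∂̄`-harmonic (`Δ_∂̄ α = ∂̄∂̄*α = 0`), yet `∂̄*α ≠ 0`.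
[folklore] -/
theorem not_isDolbeaultHarmonic_iff_torus :
    ¬ isDolbeaultHarmonic_iff (k := 1) (m := 0) metric orient := by
  intro H
  have h2 : (1 + 1 + 0 : ℕ) = 2 := rfl
  have key := (H isHermitian h2 (p := 1) (q := 1) isSmoothForm_alpha isOfType_alpha
    isSmoothForm_riemannianVolumeForm).1 (isDolbeaultHarmonic_alpha h2)
  exact dolbeaultBarAdjoint_alpha_ne_zero h2 key.2

end Charts

end TorusConjAtlas

section UniversalClosure

attribute [local instance] TorusConjAtlas.chartedSpaceT TorusConjAtlas.isManifoldT
  Complex.finrank_real_complex_fact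

/-- **`isDolbeaultHarmonic_iff` fails already over real `C^∞` surfaces charted in `ℂ`** (smooth
metric, any orientation family), in degree `k + 1 = 2`, `m = 0`: witness the rigged torus
`TorusConjAtlas.T` with the flat metric (`TorusConjAtlas.not_isDolbeaultHarmonic_iff_torus`). The
intended statement is Voisin (2002), §5.1.2 / Huybrechts (2005), Lemma 3.2.5, for compact complex
manifolds. [folklore] -/
theorem not_forall_isDolbeaultHarmonic_iff :
    ¬ ∀ (M : Type) [TopologicalSpace M] [ChartedSpace ℂ M] [IsManifold 𝓘(ℝ, ℂ) ∞ M]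
        (g : ContMDiffRiemannianMetric 𝓘(ℝ, ℂ) ∞ ℂ (fun x : M ↦ TangentSpace 𝓘(ℝ, ℂ) x))
        (o : (x : M) → Orientation ℝ (TangentSpace 𝓘(ℝ, ℂ) x) (Fin 2)),
        isDolbeaultHarmonic_iff (k := 1) (m := 0) g o :=
  fun H ↦ TorusConjAtlas.not_isDolbeaultHarmonic_iff_torus
    (H TorusConjAtlas.T TorusConjAtlas.metric TorusConjAtlas.orient)

/-- **The named fact `isDolbeaultHarmonic_iff` is false as stated.** Closed universally over
exactly the binders it elaborates with — a finite-dimensional complex normed space `E` with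
`finrank ℝ E = n`, a charted space `M` over `E` that is a *real* `C^∞` manifold (no
`[IsManifold 𝓘(ℂ, E) ω M]`: the section instance is not mentioned in the body of the `def` and
was therefore not abstracted), degrees `k`, `m`, a `C^∞` Riemannian metric `g` and an orientation
family `o` — the statement fails: witness `E = ℂ`, `n = 2`, `k = 1`, `m = 0`, the compact Hausdorff
torus `(ℝ/ℤ)²` with the `{id, conj}`-rigged real-analytic atlas `TorusConjAtlas.chartedSpaceT`, the
flat (Hermitian) metric and the orientation `TorusConjAtlas.orient`
(`TorusConjAtlas.not_isDolbeaultHarmonic_iff_torus`). Hence no closed proof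
`isDolbeaultHarmonic_iff_holds` can exist. The intended statement — Voisin (2002), §5.1.2 (proof of
Thm. 5.24) / Cor. 5.13; Huybrechts (2005), Lemma 3.2.5 — carries the complex-manifold hypothesis;
it is the corrected named fact `isDolbeaultHarmonic_iff_of_isManifold`, discharged in
`KaehlerHodgeDolbeaultHarmonicProofs.lean`. [folklore] -/
theorem not_isDolbeaultHarmonic_iff :
    ¬ ∀ {E : Type} [NormedAddCommGroup E] [NormedSpace ℂ E] {M : Type} [TopologicalSpace M]
        [ChartedSpace E M] {k m : ℕ} [FiniteDimensional ℂ E] {n : ℕ} [Fact (finrank ℝ E = n)]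
        [IsManifold 𝓘(ℝ, E) ∞ M]
        (g : ContMDiffRiemannianMetric 𝓘(ℝ, E) ∞ E (fun x : M ↦ TangentSpace 𝓘(ℝ, E) x))
        (o : (x : M) → Orientation ℝ (TangentSpace 𝓘(ℝ, E) x) (Fin n)),
        isDolbeaultHarmonic_iff (k := k) (m := m) g o :=
  fun H ↦ not_forall_isDolbeaultHarmonic_iff fun M _ _ _ g o ↦
    @H ℂ _ _ M _ _ 1 0 _ 2 Complex.finrank_real_complex_fact _ g o

end UniversalClosure

end Literature.NumberTheory.Transcendental
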